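import Mathlib
import HarnessLib
import Summits.HubbardSuperconductivity.HubbardSuperconductivity.Theses.KLProgramme
import Summits.HubbardSuperconductivity.HubbardSuperconductivity.Theorems.KLProgrammeKLRegimeCountertermV14Body

/-!
# Route `KLProgramme` — crux `KLRegimeCountertermV14` (gen-5 K3 resplit on `klPredsV14`, Δ23 / (R-I-min)) — CLOSED AT BIRTH

The COUNTERTERM child `CountertermP2 klPredsV14 klWindowC` of crux K3 `KLRegimeTwoPointLimit` at the gen-5 bundle (`…SplitBundleV14` p488735: two-leg
slot `TwoLegStepV14` (the V13 text p484180 read at `histV14`) over FUNCTION pieces `klTwoLegPieceFn … K.eval`, frames `TrigPolyC4v`): ONE admissible frame, chosen before the volume,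
renormalised at every scale and every large volume.  Proof = the body `KLRegimeSplit.CtJ.countertermP2_klPredsV14` (module `KLProgrammeKLRegimeCountertermV14Body`;
p487213 at V13; V14 body p488933 (k3c3-p2 l.1698)): the Jackson-smoothed wholesale continuation — one smoothed Picard step per scale on FrameOK's tube (self-map with constant one by the
positive Jackson kernel, `…CountertermJacksonSelfMap`; contraction by (E3c-T); exact reading `…CountertermReadingFn`; volume transfer by (E3f)).
Seats hubbard-kl-k3c3-p2 (smoothing layer, continuation, body), hubbard-kl-k3c3-p1 (reading identity), p2 (V13/V14 texts); template re-targeted V13 → V14 by plan2 g4 per k3c3-p2 l.1650 (body file name KLProgrammeKLRegimeCountertermV14Body = k3c3-p2's V14 body, pid p488933 (k3c3-p2 l.1698)).  Proof only.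
-/

noncomputable section

namespace Summit.HubbardSuperconductivity.HubbardSuperconductivity.Theorems.KLRegimeCounterterm

set_option linter.dupNamespace false -- summit = problem name (single-conjunct summit), D-0017

/-- **The counterterm child of the gen-5 K3 resplit, BY NAME**: `KLRegimeCountertermV14` (`= CountertermP2 klPredsV14 klWindowC`). -/
theorem KLRegimeCountertermV14_of :
    Summit.HubbardSuperconductivity.HubbardSuperconductivity.Theses.KLProgramme.KLRegimeCountertermV14 :=
  KLRegimeSplit.CtJ.countertermP2_klPredsV14

end Summit.HubbardSuperconductivity.HubbardSuperconductivity.Theorems.KLRegimeCounterterm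

end
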